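/-
COR-CM (cells pub-hodgecm / pub-hodgecm2, stage 2 of the Hodge ladder) — TRANSPOSITION item (vi), S-LANE CARRIERS-PLAN steps S6 × S7, ω-PART: the Hecke-level
re-cut `Transposition/Item6SupplyPinnedAssemblyAlongHoldsRestOneHecke.lean` with the theta-side carriers `Eps`/`epsOf`/`Chi`/`omega`/`rho` NO LONGER
POSITED but taken to be mc-theta-3's DEFINITIONS (`Liu2021/Def411WeilCarriers.lean`, CARRIERS-PLAN S2ε + S3), read at the face through hcomp-level's DIAGONAL
FRAME (`HComp/HermSpaceDiagonalFrame.lean`) and the CM lane's constants — exactly pin-3's ω re-cut recipe (`RECIPE-S7-omega.md` §1–§2), applied to the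
Hecke-level theorem instead of the first re-cut: ONE APPLICATION, no transport (HECKE-FIRST order, hcomp-shimura gen 11 HOME/INBOX l.7187).  Displayed data
{`iso`, `C`, `P`, `s`, `T`}; Prop {`h`, `hA`, `hs`, `hsc`, `hLiu`, `hObj`, `hirr`} (+ `hM` in §2).  pin-3 = prover-pub-hodgecm2-pin-3-g3-0 (CARRIERS-PLAN
S7 owner, single writer of `Transposition/Item6*`); BYTES DRAFTED by hcomp-shimura gen 11 (author of the S6 socket) and filed by pin-3 with this header
passage as the only change; theorems only; NEW path, FILE-ONCE.  RED-TEAM WATCHES carried (TGTBT D18.3 item 1: `P` is a FREE token family; D20 W3,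
option (γ): CITE CLASS OF `hLiu` HERE — `hLiu` asks [Liu2021] Thm. 4.18 for the oscillator `ω_s(μ, ε, χ)` OF THE DISPLAYED FAMILY `s`; it is the PRINTED
`ω(μ, ε, χ)` (App. D Step 2, l. 5217) IFF `s` is the splitting attached to `μ` (`s_ε|U(V) = ι_μ`), which NO binder of this file asserts — another
compatible `s` twists the oscillator by `ν ∘ det_V` ([HKS96 §1]) —, so the class is «Thm. 4.18 for the `s`-oscillator; = as printed under the μ-link»
(CARRIERS-PLAN row 6), NOT «as printed»; D21 row e: the Hecke action is the CONSTRUCTED `(T F ι₁ V Φ h6).rhoΩOne …`, no `rhoΩ` binder).  FRAMING: HC_CM is NOT proved; S2 = B01-S is NOT inhabited; NOT claimed: that `s` is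
Liu's splitting or that `ω` so built is irreducible (`hirr` stays a hypothesis — [Liu2021] Lem. D.1 (1)); `iso`, `C`, `P`, `s`, `T` are POSITED.
-/
import Summits.HodgeConjecture.CorCM.B01.Transposition.Item6SupplyPinnedAssemblyAlongHoldsRestOneHecke
import Summits.HodgeConjecture.CorCM.B01.Transposition.HComp.HermSpaceDiagonalFrame
import Literature.NumberTheory.Automorphic.Liu2021.Def411WeilCarriers
import Literature.NumberTheory.GelbartRogawski1991.UnitaryDualPairThetaKernelCM
import HarnessLib

set_option autoImplicit false

/-!
# B01-S and the (β)-free END display at the ω rest WITH the Hecke action on `Ω(μ)` CONSTRUCTED (S6 × S7, ω-part)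

Instantiation = pin-3's ω re-cut (`Item6SupplyPinnedAssemblyAlongHoldsRestOneOmega`) VERBATIM: `Eps := Def411WeilCarriers.Eps F⁺ (imagUnitSq F)`,
`epsOf := epsOf F⁺ (imagUnitSq F) F (imagUnit F)`, `Chi := Chi F⁺ F c̄`, `omega := omega … (hs …)`, `rho := rho … (hs …) V.adelicFinDiag`, `hChi := nonempty_chi`,
`hsm := rho_smooth …`; the Hecke datum `T` passes through unchanged.  KERNEL: one application of `faceSupply_of_thm418AsPrinted_along_conj_holds_restOne_hecke`.
Probe of record: `HOME/pinning/hcomp/hcomp-shimura/probes/OmegaHeckeDirectProbe.g11-da93592775a5.lean` rc 0 · 0 sorry · 89 s · trio.  HC_CM is NOT proved.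

References: Y. Liu, arXiv:2102.11518 = Camb. J. Math. 9 (2021): Def. 4.11–4.12 l. 2083–2108, Def. 4.16–Rem. 4.17 l. 2219–2227, Thm. 4.18 l. 2232–2245, App. D §D.1
Steps 1–3 l. 5215–5223.  S. Gelbart, J. Rogawski, Invent. Math. 105 (1991) §3.1 Prop. 3.1.1.  J. S. Milne, *Introduction to Shimura varieties* (2005) Thm. 13.6.
-/

noncomputable section

open scoped TensorProduct InnerProductSpace Kronecker

namespace Summit.HodgeConjecture.CorCM.Model

open CategoryTheory CategoryTheory.Limits AlgebraicGeometry NumberField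
open Literature.AlgebraicGeometry.Motives
open Literature.AlgebraicGeometry.HodgeTheory
open Literature.AlgebraicGeometry.ShimuraVarieties
open Literature.AlgebraicGeometry.ShimuraVarieties.UnitaryCanonicalModel
open Literature.NumberTheory.ComplexMultiplication
open Literature.NumberTheory.Automorphic
open Literature.NumberTheory.Automorphic.IdeleClassGroup
open Literature.NumberTheory.Automorphic.PicardCM
open Literature.NumberTheory.Automorphic.Liu2021
open Literature.NumberTheory.Automorphic.Liu2021.AppendixC
open Literature.NumberTheory.Automorphic.Liu2021.AppendixC.RestOne
open Literature.NumberTheory.Automorphic.Liu2021.Def411WeilCarriers (JW TW isSymm_TW isUnit_det_TW JW_eq)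
open Literature.NumberTheory.GelbartRogawski1991 Literature.NumberTheory.GelbartRogawski1991.UnitaryDualPair
open Literature.NumberTheory.Weil1964 Literature.RepresentationTheory
open Summit.HodgeConjecture.CorCM.Transposition

/-! ## §1  B01-S and the END display at the ω rest WITH THE HECKE ACTION CONSTRUCTED (by application of the Hecke-level re-cut) -/

/-- **S6 SOCKET, B01-S level, at the ω rest, DEF-FREE** (pin-3's ω re-cut `faceSupply_of_thm418AsPrinted_along_conj_holds_restOne_omega`, v1
748de22be3cf, with `rhoΩ` ↦ `T` and every reading written directly at `(T F ι₁ V Φ h6).rhoΩOne …`): displayed data {iso, C, P, s, T}, Prop {h, hA,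
hs, hsc, hLiu, hObj, hirr}.  Proof = pin-3's ω proof VERBATIM with the first re-cut replaced by the Hecke-level re-cut `…_restOne_hecke` (`hChi := nonempty_chi`,
`hsm := rho_smooth …` as there): ONE APPLICATION, all reading types agree after β — no `rw`, no `▸`, no auxiliary `def`, default heartbeats.
After S5 + bridge + adapter: `C := sec42DataOf h hA' iso`, `T := heckeTranslatesFamilyOf hU7 h hA' iso` by application (binder −1, cite +1 `hU7`).
HC_CM is NOT proved: no hypothesis is inhabited here.
[cite: Liu2021, Thm. 4.18 (FJcycle.tex l. 2232–2245), Def. 4.16 l. 2219, §4.2 l. 2074] [cite: Milne2005ShimuraVarieties, Thm. 13.6 p. 118] -/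
theorem faceSupply_of_thm418AsPrinted_along_conj_holds_restOne_omega_hecke
    (hHD : exists_isReal_hodgeModel) (hI : hodgePQ_independent_of_hodgeModel)
    (h₁ : BallQuotientUniformised) (h₃ : CMAbelianVarietyRealised)
    (h : exists_recordSystem) (hA : albanese_baseChange_isLimit_fan_jacobian)
    (iso : ∀ (F : CMField) (ι₁ : F →+* ℂ) (_ : HermSpace3 F ι₁) (_ : CMType F), ℕ → Prop)
    (C : ∀ (F : CMField) (ι₁ : F →+* ℂ) (V : HermSpace3 F ι₁) (Φ : CMType F), Sec42Data (honestP5Of h F ι₁ V Φ) (iso F ι₁ V Φ))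
    (P : ∀ (F : CMField) [IsGalois ℚ F] (ι₁ : F →+* ℂ) (_ : HermSpace3 F ι₁) (Φ : CMType F) (A : AbelianVariety F),
      (muAlgValueField F (muOfInvType ι₁ Φ) →+* A.endAlgebra) → Type)
    (s : ∀ (F : CMField) (ι₁ : F →+* ℂ) (V : HermSpace3 F ι₁) (_ : CMType F) (a : (↥(maximalRealSubfield F))ˣ),
      UnitaryGroup.adelicPair ↥(maximalRealSubfield F) F (IsCMField.complexConj F) 3 1 (Matrix.diagonal V.diagEntries) (JW ↥(maximalRealSubfield F) F a) →*
        adelicMpCont ↥(maximalRealSubfield F) (Fin (3 * 1)) (adelicGram ↥(maximalRealSubfield F) finProdFinEquiv (realDiagonal F V.diagEntries V.complexConj_diagEntries) (TW ↥(maximalRealSubfield F) a)))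
    (hs : ∀ (F : CMField) (ι₁ : F →+* ℂ) (V : HermSpace3 F ι₁) (Φ : CMType F) (a : (↥(maximalRealSubfield F))ˣ),
      (splittingDatum ↥(maximalRealSubfield F) F (IsCMField.complexConj F) 3 1 finProdFinEquiv (Matrix.diagonal V.diagEntries) (JW ↥(maximalRealSubfield F) F a) (complexConj_imagUnit F) (imagUnit_ne_zero F) (imagUnit_mul_self F) (realDiagonal_isSymm F V.diagEntries V.complexConj_diagEntries) (isSymm_TW ↥(maximalRealSubfield F) a) (isUnit_det_realDiagonal F V.diagEntries V.complexConj_diagEntries V.diagEntries_ne_zero) (isUnit_det_TW ↥(maximalRealSubfield F) a) (realDiagonal_map F V.diagEntries V.complexConj_diagEntries).symm (JW_eq ↥(maximalRealSubfield F) F a)).IsCompatible (s F ι₁ V Φ a))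
    (hsc : ∀ (F : CMField) (ι₁ : F →+* ℂ) (V : HermSpace3 F ι₁) (Φ : CMType F) (a : (↥(maximalRealSubfield F))ˣ),
      Continuous (pairSplitting ↥(maximalRealSubfield F) F (IsCMField.complexConj F) 3 1 finProdFinEquiv (Matrix.diagonal V.diagEntries) (JW ↥(maximalRealSubfield F) F a) (s F ι₁ V Φ a)))
    (T : ∀ (F : CMField) (ι₁ : F →+* ℂ) (V : HermSpace3 F ι₁) (Φ : CMType F), 6 ≤ Module.finrank ℚ F →
      (C F ι₁ V Φ).HeckeTranslates)
    (hLiu : ∀ (F : CMField) [IsGalois ℚ F] (h6 : 6 ≤ Module.finrank ℚ F) (Φ : CMType F) (ι₁ : F →+* ℂ), ι₁ ∈ Φ.1 →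
      ∀ V : HermSpace3 F ι₁, Thm418AsPrintedC (C F ι₁ V Φ)
        (restOne (C F ι₁ V Φ) (AlgHom.id ℚ F) ι₁ (isConjugateSymplectic_muOfInvType ι₁ Φ) (hasWeight_one_muOfInvType ι₁ Φ) (Def45.Carriers.ofPolDR (muOfInvType ι₁ Φ) (P F ι₁ V Φ))
            (Def411WeilCarriers.Eps ↥(maximalRealSubfield F) (imagUnitSq F)) (Def411WeilCarriers.epsOf ↥(maximalRealSubfield F) (imagUnitSq F) F (imagUnit F)) (Def411WeilCarriers.Chi ↥(maximalRealSubfield F) F (IsCMField.complexConj F))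
            (Def411WeilCarriers.omega ↥(maximalRealSubfield F) F (IsCMField.complexConj F) 3 finProdFinEquiv (Matrix.diagonal V.diagEntries) (complexConj_imagUnit F) (imagUnit_ne_zero F) (imagUnit_mul_self F) (realDiagonal_isSymm F V.diagEntries V.complexConj_diagEntries) (isUnit_det_realDiagonal F V.diagEntries V.complexConj_diagEntries V.diagEntries_ne_zero) (realDiagonal_map F V.diagEntries V.complexConj_diagEntries).symm (hs F ι₁ V Φ))
            (Def411WeilCarriers.rho ↥(maximalRealSubfield F) F (IsCMField.complexConj F) 3 finProdFinEquiv (Matrix.diagonal V.diagEntries) (complexConj_imagUnit F) (imagUnit_ne_zero F) (imagUnit_mul_self F) (realDiagonal_isSymm F V.diagEntries V.complexConj_diagEntries) (isUnit_det_realDiagonal F V.diagEntries V.complexConj_diagEntries V.diagEntries_ne_zero) (realDiagonal_map F V.diagEntries V.complexConj_diagEntries).symm (hs F ι₁ V Φ) V.adelicFinDiag.toMulEquiv.toMonoidHom) ((T F ι₁ V Φ h6).rhoΩOne (AlgHom.id ℚ F) ι₁ (isConjugateSymplectic_muOfInvType ι₁ Φ) (hasWeight_one_muOfInvType ι₁ Φ)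 (Def45.Carriers.ofPolDR (muOfInvType ι₁ Φ) (P F ι₁ V Φ)))))
    (hObj : ∀ (F : CMField) [IsGalois ℚ F], 6 ≤ Module.finrank ℚ F → ∀ (Φ : CMType F) (ι₁ : F →+* ℂ), ι₁ ∈ Φ.1 →
      ∀ V : HermSpace3 F ι₁,
        Nonempty (Def45.CMDatum (AlgHom.id ℚ F) ι₁ (isConjugateSymplectic_muOfInvType ι₁ Φ) (hasWeight_one_muOfInvType ι₁ Φ) (Def45.Carriers.ofPolDR (muOfInvType ι₁ Φ) (P F ι₁ V Φ))))
    (hirr : ∀ (F : CMField) [IsGalois ℚ F] (h6 : 6 ≤ Module.finrank ℚ F) (Φ : CMType F) (ι₁ : F →+* ℂ), ι₁ ∈ Φ.1 →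
      ∀ (V : HermSpace3 F ι₁)
        (i : (toThm418Data (C F ι₁ V Φ)
          (restOne (C F ι₁ V Φ) (AlgHom.id ℚ F) ι₁ (isConjugateSymplectic_muOfInvType ι₁ Φ) (hasWeight_one_muOfInvType ι₁ Φ) (Def45.Carriers.ofPolDR (muOfInvType ι₁ Φ) (P F ι₁ V Φ))
            (Def411WeilCarriers.Eps ↥(maximalRealSubfield F) (imagUnitSq F)) (Def411WeilCarriers.epsOf ↥(maximalRealSubfield F) (imagUnitSq F) F (imagUnit F)) (Def411WeilCarriers.Chi ↥(maximalRealSubfield F) F (IsCMField.complexConj F))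
            (Def411WeilCarriers.omega ↥(maximalRealSubfield F) F (IsCMField.complexConj F) 3 finProdFinEquiv (Matrix.diagonal V.diagEntries) (complexConj_imagUnit F) (imagUnit_ne_zero F) (imagUnit_mul_self F) (realDiagonal_isSymm F V.diagEntries V.complexConj_diagEntries) (isUnit_det_realDiagonal F V.diagEntries V.complexConj_diagEntries V.diagEntries_ne_zero) (realDiagonal_map F V.diagEntries V.complexConj_diagEntries).symm (hs F ι₁ V Φ))
            (Def411WeilCarriers.rho ↥(maximalRealSubfield F) F (IsCMField.complexConj F) 3 finProdFinEquiv (Matrix.diagonal V.diagEntries) (complexConj_imagUnit F) (imagUnit_ne_zero F) (imagUnit_mul_self F) (realDiagonal_isSymm F V.diagEntries V.complexConj_diagEntries) (isUnit_det_realDiagonal F V.diagEntries V.complexConj_diagEntries V.diagEntries_ne_zero) (realDiagonal_map F V.diagEntries V.complexConj_diagEntries).symm (hs F ι₁ V Φ) V.adelicFinDiag.toMulEquiv.toMonoidHom) ((T F ι₁ V Φ h6).rhoΩOne (AlgHom.id ℚ F) ι₁ (isConjugateSymplectic_muOfInvType ι₁ Φ) (hasWeight_one_muOfInvType ι₁ Φ)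 (Def45.Carriers.ofPolDR (muOfInvType ι₁ Φ) (P F ι₁ V Φ))))).AdmIndex),
        (Def411WeilCarriers.rho ↥(maximalRealSubfield F) F (IsCMField.complexConj F) 3 finProdFinEquiv (Matrix.diagonal V.diagEntries) (complexConj_imagUnit F) (imagUnit_ne_zero F) (imagUnit_mul_self F) (realDiagonal_isSymm F V.diagEntries V.complexConj_diagEntries) (isUnit_det_realDiagonal F V.diagEntries V.complexConj_diagEntries V.diagEntries_ne_zero) (realDiagonal_map F V.diagEntries V.complexConj_diagEntries).symm (hs F ι₁ V Φ) V.adelicFinDiag.toMulEquiv.toMonoidHom i.1.1 i.1.2).IsIrreducible) :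
    (picardCMUniverse hHD hI h₁ h₃).FaceSupply :=
  faceSupply_of_thm418AsPrinted_along_conj_holds_restOne_hecke hHD hI h₁ h₃ h hA iso C P
    (fun F _ _ _ => Def411WeilCarriers.Eps ↥(maximalRealSubfield F) (imagUnitSq F))
    (fun F _ _ _ => Def411WeilCarriers.epsOf ↥(maximalRealSubfield F) (imagUnitSq F) F (imagUnit F))
    (fun F _ _ _ => Def411WeilCarriers.Chi ↥(maximalRealSubfield F) F (IsCMField.complexConj F))
    (fun F ι₁ V Φ => Def411WeilCarriers.omega ↥(maximalRealSubfield F) F (IsCMField.complexConj F) 3 finProdFinEquiv (Matrix.diagonal V.diagEntries) (complexConj_imagUnit F) (imagUnit_ne_zero F) (imagUnit_mul_self F) (realDiagonal_isSymm F V.diagEntries V.complexConj_diagEntries) (isUnit_det_realDiagonal F V.diagEntries V.complexConj_diagEntries V.diagEntries_ne_zero) (realDiagonal_map F V.diagEntries V.complexConj_diagEntries).symm (hs F ι₁ V Φ))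
    (fun F ι₁ V Φ => Def411WeilCarriers.rho ↥(maximalRealSubfield F) F (IsCMField.complexConj F) 3 finProdFinEquiv (Matrix.diagonal V.diagEntries) (complexConj_imagUnit F) (imagUnit_ne_zero F) (imagUnit_mul_self F) (realDiagonal_isSymm F V.diagEntries V.complexConj_diagEntries) (isUnit_det_realDiagonal F V.diagEntries V.complexConj_diagEntries V.diagEntries_ne_zero) (realDiagonal_map F V.diagEntries V.complexConj_diagEntries).symm (hs F ι₁ V Φ) V.adelicFinDiag.toMulEquiv.toMonoidHom)
    T hLiu hObj
    -- a character exists: the trivial one (`Def411WeilCarriers.nonempty_chi`)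
    (fun F _ _ _ _ _ _ => Def411WeilCarriers.nonempty_chi ↥(maximalRealSubfield F) F (IsCMField.complexConj F))
    hirr
    -- «admissible»: smooth vectors, from `WeilCoinv.weilCoinv_comp_smooth` through `Def411WeilCarriers.rho_smooth`, `ι` and the pair
    -- splittings continuous
    (fun F _ _ Φ ι₁ _ V i v =>
      Def411WeilCarriers.rho_smooth ↥(maximalRealSubfield F) F (IsCMField.complexConj F) 3 finProdFinEquiv (Matrix.diagonal V.diagEntries) (complexConj_imagUnit F) (imagUnit_ne_zero F) (imagUnit_mul_self F) (realDiagonal_isSymm F V.diagEntries V.complexConj_diagEntries) (isUnit_det_realDiagonal F V.diagEntries V.complexConj_diagEntries V.diagEntries_ne_zero) (realDiagonal_map F V.diagEntries V.complexConj_diagEntries).symm (hs F ι₁ V Φ)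
        V.adelicFinDiag.toMulEquiv.toMonoidHom V.continuous_adelicFinDiag_toMonoidHom (hsc F ι₁ V Φ) i.1.1 i.1.2 v)

section MeetingFormHeckeOmega

open MeasureTheory
open Prior.Perl34File (Perl34.IsolationSetting)
open Prior.Perl34File.Perl34

/-- **END DISPLAY, (β)-FREE MEETING FORM, at the ω rest WITH THE HECKE ACTION, DEF-FREE** (`let U := U_rec`): data {iso, C, P, s, T}; Prop {h,
hA, hs, hsc, hLiu, hObj, hirr} + hM.  HC_CM is NOT proved: no hypothesis is inhabited here.
[cite: Liu2021, Thm. 4.18 (FJcycle.tex l. 2232–2245), Def. 4.16 l. 2219] [cite: Milne2005ShimuraVarieties, Thm. 13.6 p. 118] -/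
theorem hc_cm_of_thm418AsPrinted_along_conj_holds_restOne_omega_hecke_meeting_rec
    (h : exists_recordSystem) (hA : albanese_baseChange_isLimit_fan_jacobian)
    (iso : ∀ (F : CMField) (ι₁ : F →+* ℂ) (_ : HermSpace3 F ι₁) (_ : CMType F), ℕ → Prop)
    (C : ∀ (F : CMField) (ι₁ : F →+* ℂ) (V : HermSpace3 F ι₁) (Φ : CMType F), Sec42Data (honestP5Of h F ι₁ V Φ) (iso F ι₁ V Φ))
    (P : ∀ (F : CMField) [IsGalois ℚ F] (ι₁ : F →+* ℂ) (_ : HermSpace3 F ι₁) (Φ : CMType F) (A : AbelianVariety F),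
      (muAlgValueField F (muOfInvType ι₁ Φ) →+* A.endAlgebra) → Type)
    (s : ∀ (F : CMField) (ι₁ : F →+* ℂ) (V : HermSpace3 F ι₁) (_ : CMType F) (a : (↥(maximalRealSubfield F))ˣ),
      UnitaryGroup.adelicPair ↥(maximalRealSubfield F) F (IsCMField.complexConj F) 3 1 (Matrix.diagonal V.diagEntries) (JW ↥(maximalRealSubfield F) F a) →*
        adelicMpCont ↥(maximalRealSubfield F) (Fin (3 * 1)) (adelicGram ↥(maximalRealSubfield F) finProdFinEquiv (realDiagonal F V.diagEntries V.complexConj_diagEntries) (TW ↥(maximalRealSubfield F) a)))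
    (hs : ∀ (F : CMField) (ι₁ : F →+* ℂ) (V : HermSpace3 F ι₁) (Φ : CMType F) (a : (↥(maximalRealSubfield F))ˣ),
      (splittingDatum ↥(maximalRealSubfield F) F (IsCMField.complexConj F) 3 1 finProdFinEquiv (Matrix.diagonal V.diagEntries) (JW ↥(maximalRealSubfield F) F a) (complexConj_imagUnit F) (imagUnit_ne_zero F) (imagUnit_mul_self F) (realDiagonal_isSymm F V.diagEntries V.complexConj_diagEntries) (isSymm_TW ↥(maximalRealSubfield F) a) (isUnit_det_realDiagonal F V.diagEntries V.complexConj_diagEntries V.diagEntries_ne_zero) (isUnit_det_TW ↥(maximalRealSubfield F) a) (realDiagonal_map F V.diagEntries V.complexConj_diagEntries).symm (JW_eq ↥(maximalRealSubfield F) F a)).IsCompatible (s F ι₁ V Φ a))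
    (hsc : ∀ (F : CMField) (ι₁ : F →+* ℂ) (V : HermSpace3 F ι₁) (Φ : CMType F) (a : (↥(maximalRealSubfield F))ˣ),
      Continuous (pairSplitting ↥(maximalRealSubfield F) F (IsCMField.complexConj F) 3 1 finProdFinEquiv (Matrix.diagonal V.diagEntries) (JW ↥(maximalRealSubfield F) F a) (s F ι₁ V Φ a)))
    (T : ∀ (F : CMField) (ι₁ : F →+* ℂ) (V : HermSpace3 F ι₁) (Φ : CMType F), 6 ≤ Module.finrank ℚ F →
      (C F ι₁ V Φ).HeckeTranslates)
    (hLiu : ∀ (F : CMField) [IsGalois ℚ F] (h6 : 6 ≤ Module.finrank ℚ F) (Φ : CMType F) (ι₁ : F →+* ℂ), ι₁ ∈ Φ.1 →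
      ∀ V : HermSpace3 F ι₁, Thm418AsPrintedC (C F ι₁ V Φ)
        (restOne (C F ι₁ V Φ) (AlgHom.id ℚ F) ι₁ (isConjugateSymplectic_muOfInvType ι₁ Φ) (hasWeight_one_muOfInvType ι₁ Φ) (Def45.Carriers.ofPolDR (muOfInvType ι₁ Φ) (P F ι₁ V Φ))
            (Def411WeilCarriers.Eps ↥(maximalRealSubfield F) (imagUnitSq F)) (Def411WeilCarriers.epsOf ↥(maximalRealSubfield F) (imagUnitSq F) F (imagUnit F)) (Def411WeilCarriers.Chi ↥(maximalRealSubfield F) F (IsCMField.complexConj F))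
            (Def411WeilCarriers.omega ↥(maximalRealSubfield F) F (IsCMField.complexConj F) 3 finProdFinEquiv (Matrix.diagonal V.diagEntries) (complexConj_imagUnit F) (imagUnit_ne_zero F) (imagUnit_mul_self F) (realDiagonal_isSymm F V.diagEntries V.complexConj_diagEntries) (isUnit_det_realDiagonal F V.diagEntries V.complexConj_diagEntries V.diagEntries_ne_zero) (realDiagonal_map F V.diagEntries V.complexConj_diagEntries).symm (hs F ι₁ V Φ))
            (Def411WeilCarriers.rho ↥(maximalRealSubfield F) F (IsCMField.complexConj F) 3 finProdFinEquiv (Matrix.diagonal V.diagEntries) (complexConj_imagUnit F) (imagUnit_ne_zero F) (imagUnit_mul_self F) (realDiagonal_isSymm F V.diagEntries V.complexConj_diagEntries) (isUnit_det_realDiagonal F V.diagEntries V.complexConj_diagEntries V.diagEntries_ne_zero) (realDiagonal_map F V.diagEntries V.complexConj_diagEntries).symm (hs F ι₁ V Φ) V.adelicFinDiag.toMulEquiv.toMonoidHom) ((T F ι₁ V Φ h6).rhoΩOne (AlgHom.id ℚ F) ι₁ (isConjugateSymplectic_muOfInvType ι₁ Φ) (hasWeight_one_muOfInvType ι₁ Φ)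 (Def45.Carriers.ofPolDR (muOfInvType ι₁ Φ) (P F ι₁ V Φ)))))
    (hObj : ∀ (F : CMField) [IsGalois ℚ F], 6 ≤ Module.finrank ℚ F → ∀ (Φ : CMType F) (ι₁ : F →+* ℂ), ι₁ ∈ Φ.1 →
      ∀ V : HermSpace3 F ι₁,
        Nonempty (Def45.CMDatum (AlgHom.id ℚ F) ι₁ (isConjugateSymplectic_muOfInvType ι₁ Φ) (hasWeight_one_muOfInvType ι₁ Φ) (Def45.Carriers.ofPolDR (muOfInvType ι₁ Φ) (P F ι₁ V Φ))))
    (hirr : ∀ (F : CMField) [IsGalois ℚ F] (h6 : 6 ≤ Module.finrank ℚ F) (Φ : CMType F) (ι₁ : F →+* ℂ), ι₁ ∈ Φ.1 →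
      ∀ (V : HermSpace3 F ι₁)
        (i : (toThm418Data (C F ι₁ V Φ)
          (restOne (C F ι₁ V Φ) (AlgHom.id ℚ F) ι₁ (isConjugateSymplectic_muOfInvType ι₁ Φ) (hasWeight_one_muOfInvType ι₁ Φ) (Def45.Carriers.ofPolDR (muOfInvType ι₁ Φ) (P F ι₁ V Φ))
            (Def411WeilCarriers.Eps ↥(maximalRealSubfield F) (imagUnitSq F)) (Def411WeilCarriers.epsOf ↥(maximalRealSubfield F) (imagUnitSq F) F (imagUnit F)) (Def411WeilCarriers.Chi ↥(maximalRealSubfield F) F (IsCMField.complexConj F))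
            (Def411WeilCarriers.omega ↥(maximalRealSubfield F) F (IsCMField.complexConj F) 3 finProdFinEquiv (Matrix.diagonal V.diagEntries) (complexConj_imagUnit F) (imagUnit_ne_zero F) (imagUnit_mul_self F) (realDiagonal_isSymm F V.diagEntries V.complexConj_diagEntries) (isUnit_det_realDiagonal F V.diagEntries V.complexConj_diagEntries V.diagEntries_ne_zero) (realDiagonal_map F V.diagEntries V.complexConj_diagEntries).symm (hs F ι₁ V Φ))
            (Def411WeilCarriers.rho ↥(maximalRealSubfield F) F (IsCMField.complexConj F) 3 finProdFinEquiv (Matrix.diagonal V.diagEntries) (complexConj_imagUnit F) (imagUnit_ne_zero F) (imagUnit_mul_self F) (realDiagonal_isSymm F V.diagEntries V.complexConj_diagEntries) (isUnit_det_realDiagonal F V.diagEntries V.complexConj_diagEntries V.diagEntries_ne_zero) (realDiagonal_map F V.diagEntries V.complexConj_diagEntries).symm (hs F ι₁ V Φ) V.adelicFinDiag.toMulEquiv.toMonoidHom) ((T F ι₁ V Φ h6).rhoΩOne (AlgHom.id ℚ F) ι₁ (isConjugateSymplectic_muOfInvType ι₁ Φ) (hasWeight_one_muOfInvType ι₁ Φ)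 (Def45.Carriers.ofPolDR (muOfInvType ι₁ Φ) (P F ι₁ V Φ))))).AdmIndex),
        (Def411WeilCarriers.rho ↥(maximalRealSubfield F) F (IsCMField.complexConj F) 3 finProdFinEquiv (Matrix.diagonal V.diagEntries) (complexConj_imagUnit F) (imagUnit_ne_zero F) (imagUnit_mul_self F) (realDiagonal_isSymm F V.diagEntries V.complexConj_diagEntries) (isUnit_det_realDiagonal F V.diagEntries V.complexConj_diagEntries V.diagEntries_ne_zero) (realDiagonal_map F V.diagEntries V.complexConj_diagEntries).symm (hs F ι₁ V Φ) V.adelicFinDiag.toMulEquiv.toMonoidHom i.1.1 i.1.2).IsIrreducible) :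
    let U := picardCMUniverse exists_isReal_hodgeModel_holds hodgePQ_independent_of_hodgeModel_holds
      BallQuotient.ballQuotientUniformised_holds cmAbelianVarietyRealised_holds
    let hU := ballQuotientUniformisedDatum_of BallQuotient.ballQuotientUniformised_holds
    (∀ (F : CMField), IsGalois ℚ F → 6 ≤ Module.finrank ℚ F → ∀ (f : Face F) (ι₁ : F →+* ℂ), f.Admissible ι₁ →
      ∀ V : HermSpace3 F ι₁,
      ∃ (H CG G SK SigIdx SigIdxG : Type) (_ : NormedAddCommGroup H) (_ : InnerProductSpace ℂ H) (_ : CompleteSpace H)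
        (_ : NormedAddCommGroup CG) (_ : NormedSpace ℂ CG) (_ : Group G) (_ : TopologicalSpace G) (_ : TopologicalSpace SK)
        (S : Perl34.IsolationSetting H (Lp ℂ 2 V.autMeasure) CG G SK SigIdx SigIdxG),
        (∀ (Γ : Level V) (ω₁ ω₂ : U.CohC (U.pms F ι₁ V Γ) 1),
          ω₁ ∈ U.Uiso Γ F (f.psi 0) ι₁ → ω₂ ∈ U.Uiso Γ F (f.psi 1) ι₁ →
            embOf exists_isReal_hodgeModel_holds hodgePQ_independent_of_hodgeModel_holds hU cmAbelianVarietyRealised_holds Γ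
                (U.cup2C (U.pms F ι₁ V Γ) 1 ω₁ ω₂) ≠ 0 →
              ∃ u ∈ S.t12.S12,
                ⟪embOf exists_isReal_hodgeModel_holds hodgePQ_independent_of_hodgeModel_holds hU cmAbelianVarietyRealised_holds Γ
                    (U.cup2C (U.pms F ι₁ V Γ) 1 ω₁ ω₂), u⟫_ℂ ≠ 0) ∧
        (∀ χ : S.t34.X, S.t34.allowed χ → ∀ (Φ : SK) (Γ₁ : Level V)
          (ω₁ ω₂ : U.CohC (U.pms F ι₁ V Γ₁) 1),
          ω₁ ∈ U.Uiso Γ₁ F (f.psi 0) ι₁ →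
          ω₂ ∈ U.Uiso Γ₁ F (f.psi 1) ι₁ →
            ⟪embOf exists_isReal_hodgeModel_holds hodgePQ_independent_of_hodgeModel_holds hU cmAbelianVarietyRealised_holds Γ₁
                (U.cup2C (U.pms F ι₁ V Γ₁) 1 ω₁ ω₂),
              S.t34.ϑ χ Φ⟫_ℂ ≠ 0 →
              ∃ (Γ : Level V) (ω : Fin 4 → U.CohC (U.pms F ι₁ V Γ) 1),
                (∀ i, ω i ∈ U.Uiso Γ F (f.psi i) ι₁) ∧
                  ⟪embOf exists_isReal_hodgeModel_holds hodgePQ_independent_of_hodgeModel_holds hU cmAbelianVarietyRealised_holds Γ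
                      (U.cup2C (U.pms F ι₁ V Γ) 1 (ω 2) (ω 3)),
                    embOf exists_isReal_hodgeModel_holds hodgePQ_independent_of_hodgeModel_holds hU cmAbelianVarietyRealised_holds Γ
                      (U.cup2C (U.pms F ι₁ V Γ) 1 (ω 0) (ω 1))⟫_ℂ
                    ≠ 0)) →
    HC_CM :=
  fun hM ↦ hc_cm_of_supply_of_settingMeetSat_embOf exists_isReal_hodgeModel_holds hodgePQ_independent_of_hodgeModel_holds
    BallQuotient.ballQuotientUniformised_holds cmAbelianVarietyRealised_holds deligneMilne1982_Thm_6_20_full_holds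
    (faceSupply_of_thm418AsPrinted_along_conj_holds_restOne_omega_hecke _ _ _ _ h hA iso C P s hs hsc T hLiu hObj hirr) hM

end MeetingFormHeckeOmega

end Summit.HodgeConjecture.CorCM.Model

end
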